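import Literature.NumberTheory.GaloisRepresentations.ContinuousCohomologyVanishing
import HarnessLib

/-!
# The long exact cohomology sequence in every degree for degreewise short exact complexes of
# topological modules (element form, with the connecting homomorphism)

Mathlib's continuous group cohomology `continuousCohomology n X` is the homology of the complex of
homogeneous cochains in the non-abelian category `TopModuleCat R`, and (as of this Mathlib) has no
long exact sequence.  The tree has the connecting maps `δ₀ : H⁰ → H¹`, `δ₁ : H¹ → H²` with their
inhomogeneous cocycle formulas (`ContinuousCohomologyConnecting.lean`) and three pieces of the long
exact sequence in *vanishing* form (`ContinuousCohomologyVanishing.lean`).  This file proves the long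
exact sequence **in every degree `n`**, in element form, for maps of cochain complexes
`φ : K ⟶ L`, `ψ : L ⟶ M` of topological `R`-modules indexed by `ℕ` that are **degreewise short
exact** (hypotheses `hcomp`, `hinj`, `hmid`, `hsurj`, the conventions of
`subsingleton_homology_X₃`):

* `homologyMap_comp_apply_eq_zero` : `Hⁿ(ψ) ∘ Hⁿ(φ) = 0`;
* `exists_homologyMap_eq_of_homologyMap_eq_zero` : exactness at `Hⁿ(L)` (all `n`);
* `homologyMap_zero_injective` : `H⁰(φ)` is injective;
* `exists_connectingHom` : there is an `R`-linear **connecting homomorphism**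
  `δ : Hⁿ(M) → Hⁿ⁺¹(K)` with `δ [ψ b] = [x]` whenever `φ x = d b` (the snake recipe), and for ANY
  `R`-linear `δ` with this property: `ker Hⁿ⁺¹(φ) ⊆ im δ` (`exists_connecting_eq_of_homologyMap_eq_zero`),
  `ker δ ⊆ im Hⁿ(ψ)` (`exists_homologyMap_eq_of_connecting_eq_zero`), `δ ∘ Hⁿ(ψ) = 0`
  (`connecting_homologyMap_apply`) and `Hⁿ⁺¹(φ) ∘ δ = 0` (`homologyMap_connecting_apply`).

The connecting homomorphism is packaged as an existence statement plus a characterising property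
(rather than a definition) so that every result here is a theorem; its value on classes is pinned
down by the characterisation (`connecting_cxClass_eq`), hence it is unique.

The sequel `DiscreteCochainsLongExact.lean` specialises this to a short exact sequence
`0 → M₁ → M₂ → M₃ → 0` of discrete modules over a compact group (`IsSES`, whose complexes of
homogeneous cochains are degreewise short exact by `cochainsHom_injective` /
`cochainsHom_exact_mid` / `cochainsHom_surjective` of `DiscreteCochains.lean`).  This is Shatz,
*Profinite groups, arithmetic, and geometry*, Ch. II §1 Prop. 3 / Serre, *Cohomologie galoisienne*,
I §2.2 ("suite exacte de cohomologie") / NSW (1.3.2), for Mathlib's homogeneous continuous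
cochains, in all degrees; this file is the pure homological-algebra layer (no group, no topology
on the group is used: only complexes of topological modules and the tree's explicit classes
`cxClass` of `ContinuousH1.lean`).

## What is NOT here

Compatibility of the degree-`0`/`1` connecting maps obtained here with the explicit `δ₀`, `δ₁` of
`ContinuousCohomologyConnecting.lean` is not asserted (both are characterised by the same snake
recipe on cochains, in different cochain models).  No naturality of `δ` in the short exact sequence.

## References

* S. S. Shatz, *Profinite groups, arithmetic, and geometry*, Ann. of Math. Studies 67 (1972),
  Ch. II §1 Prop. 2, Prop. 3. [Shatz1972]
* J.-P. Serre, *Cohomologie galoisienne*, LNM 5 (5e éd. 1994) / *Galois Cohomology* (1997),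
  I §2.2. [SerreGaloisCohomology1997]
* J. Neukirch, A. Schmidt, K. Wingberg, *Cohomology of Number Fields*, 2nd ed. (2008), (1.3.2).
  [NeukirchSchmidtWingberg2008]
-/

noncomputable section

open CategoryTheory Limits

universe u v

namespace Literature.NumberTheory.GaloisRepresentations

/-! ### Complexes of topological modules indexed by `ℕ`: the long exact sequence in element form -/

section Complexes

variable {R : Type u} [Ring R] [TopologicalSpace R]
variable {K L M : CochainComplex (TopModuleCat.{v} R) ℕ} (φ : K ⟶ L) (ψ : L ⟶ M)

/-- `(ComplexShape.up ℕ).prev 0 = 0`. [folklore] -/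
private theorem up_nat_prev_zero : (ComplexShape.up ℕ).prev 0 = 0 := CochainComplex.prev_nat_zero

/-- Two cycles that differ by a boundary have the same class (the relation defining `Hⁿ` as
cocycles modulo coboundaries, for Mathlib's homology object of a complex of topological modules).
[cite: Shatz1972, Ch. II §1 Prop. 3] -/
theorem cxClass_eq_cxClass_of_sub_eq_d (K : CochainComplex (TopModuleCat.{v} R) ℕ) (i i₀ : ℕ)
    (hi₀ : (ComplexShape.up ℕ).prev i = i₀) (x x' : K.X i) (hx : K.d i (i + 1) x = 0)
    (hx' : K.d i (i + 1) x' = 0) (y : K.X i₀) (hy : K.d i₀ i y = x - x') :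
    cxClass K i (i + 1) (up_nat_next i) x hx = cxClass K i (i + 1) (up_nat_next i) x' hx' := by
  have hsub : K.d i (i + 1) (x - x') = 0 := by rw [map_sub, hx, hx', sub_zero]
  have h0 : cxClass K i (i + 1) (up_nat_next i) (x - x') hsub = 0 :=
    (cxClass_eq_zero_iff K i (i + 1) (up_nat_next i) i₀ hi₀ (x - x') hsub).2 ⟨y, hy⟩
  have hadd : K.d i (i + 1) ((x - x') + x') = 0 := by rw [sub_add_cancel, hx]
  rw [cxClass_congr (hx := hx) (hx' := hadd) (sub_add_cancel x x').symm,
    cxClass_add K i (i + 1) (up_nat_next i) (x - x') x' hsub hx', h0, zero_add]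

/-- **`Hⁿ(ψ) ∘ Hⁿ(φ) = 0`** when `ψ ∘ φ = 0` degreewise. [cite: Shatz1972, Ch. II §1 Prop. 3] -/
theorem homologyMap_comp_apply_eq_zero (hcomp : ∀ i (x : K.X i), ψ.f i (φ.f i x) = 0) (n : ℕ)
    (a : K.homology n) :
    HomologicalComplex.homologyMap ψ n (HomologicalComplex.homologyMap φ n a) = 0 := by
  obtain ⟨x, hx, rfl⟩ := cxClass_surjective K n (n + 1) (up_nat_next n) a
  have hφx : L.d n (n + 1) (φ.f n x) = 0 := by rw [hom_f_d_apply, hx, map_zero]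
  rw [homologyMap_cxClass φ n (n + 1) (up_nat_next n) x hx (φ.f n x) hφx rfl,
    homologyMap_cxClass ψ n (n + 1) (up_nat_next n) (φ.f n x) hφx 0 (map_zero _) (hcomp n x).symm]
  exact (cxClass_eq_zero_iff M n (n + 1) (up_nat_next n) _ rfl 0 (map_zero _)).2 ⟨0, map_zero _⟩

/-- **Exactness at `Hⁿ(L)`, every degree**: if `K → L → M` is degreewise short exact, a class of
`Hⁿ(L)` killed by `Hⁿ(ψ)` comes from `Hⁿ(K)`. [cite: Shatz1972, Ch. II §1 Prop. 3] -/
theorem exists_homologyMap_eq_of_homologyMap_eq_zero (hinj : ∀ i, Function.Injective (φ.f i))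
    (hmid : ∀ i (y : L.X i), ψ.f i y = 0 → ∃ x, φ.f i x = y)
    (hsurj : ∀ i, Function.Surjective (ψ.f i)) (n : ℕ) (c : L.homology n)
    (hc : HomologicalComplex.homologyMap ψ n c = 0) :
    ∃ a : K.homology n, HomologicalComplex.homologyMap φ n a = c := by
  obtain ⟨b, hb, rfl⟩ := cxClass_surjective L n (n + 1) (up_nat_next n) c
  have hψb : M.d n (n + 1) (ψ.f n b) = 0 := by rw [hom_f_d_apply, hb, map_zero]
  rw [homologyMap_cxClass ψ n (n + 1) (up_nat_next n) b hb (ψ.f n b) hψb rfl,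
    cxClass_eq_zero_iff M n (n + 1) (up_nat_next n) _ rfl] at hc
  obtain ⟨z, hz⟩ := hc
  obtain ⟨b₀, rfl⟩ := hsurj _ z
  -- `b - d b₀` maps to `0` in `M`, hence is `φ a`
  have h1 : ψ.f n (b - L.d _ n b₀) = 0 := by rw [map_sub, ← hom_f_d_apply, hz, sub_self]
  obtain ⟨a, ha⟩ := hmid n _ h1
  have hda : K.d n (n + 1) a = 0 := by
    apply hinj (n + 1)
    rw [← hom_f_d_apply, ha, map_sub, d_d_apply, sub_zero, hb, map_zero]
  refine ⟨cxClass K n (n + 1) (up_nat_next n) a hda, ?_⟩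
  have hφa : L.d n (n + 1) (φ.f n a) = 0 := by rw [hom_f_d_apply, hda, map_zero]
  rw [homologyMap_cxClass φ n (n + 1) (up_nat_next n) a hda (φ.f n a) hφa rfl]
  exact (cxClass_eq_cxClass_of_sub_eq_d L n _ rfl b (φ.f n a) hb hφa b₀
    (by rw [ha, sub_sub_cancel])).symm

/-- **`H⁰(φ)` is injective** for a degreewise injective `φ` (there are no boundaries in degree
`0`). [cite: Shatz1972, Ch. II §1 Prop. 3] -/
theorem homologyMap_zero_injective (hinj : ∀ i, Function.Injective (φ.f i)) :
    Function.Injective (HomologicalComplex.homologyMap φ 0) := by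
  refine (injective_iff_map_eq_zero _).2 fun a ha => ?_
  obtain ⟨x, hx, rfl⟩ := cxClass_surjective K 0 1 (up_nat_next 0) a
  have hφx : L.d 0 1 (φ.f 0 x) = 0 := by rw [hom_f_d_apply, hx, map_zero]
  rw [homologyMap_cxClass φ 0 1 (up_nat_next 0) x hx (φ.f 0 x) hφx rfl,
    cxClass_eq_zero_iff L 0 1 (up_nat_next 0) _ rfl] at ha
  obtain ⟨y, hy⟩ := ha
  have hd0 : L.d ((ComplexShape.up ℕ).prev 0) 0 = 0 :=
    L.shape _ _ (by rw [up_nat_prev_zero]; simp)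
  have hφx0 : φ.f 0 x = 0 := by rw [← hy, hd0]; rfl
  have hx0 : x = 0 := hinj 0 (by rw [hφx0, map_zero])
  subst hx0
  exact (cxClass_eq_zero_iff K 0 1 (up_nat_next 0) _ rfl 0 hx).2 ⟨0, map_zero _⟩

/-! #### The connecting homomorphism `δ : Hⁿ(M) → Hⁿ⁺¹(K)` -/

/-- The snake recipe: for a cocycle `z = ψ b` of `M` (any lift `b`), `d b = φ x` for a unique
cocycle `x` of `K`. [cite: Shatz1972, Ch. II §1 Prop. 3] -/
theorem exists_lift_d_eq (hinj : ∀ i, Function.Injective (φ.f i))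
    (hmid : ∀ i (y : L.X i), ψ.f i y = 0 → ∃ x, φ.f i x = y) (n : ℕ) (z : M.X n)
    (hz : M.d n (n + 1) z = 0) (b : L.X n) (hb : ψ.f n b = z) :
    ∃ x : K.X (n + 1), φ.f (n + 1) x = L.d n (n + 1) b ∧ K.d (n + 1) (n + 2) x = 0 := by
  have hdb : ψ.f (n + 1) (L.d n (n + 1) b) = 0 := by rw [← hom_f_d_apply, hb, hz]
  obtain ⟨x, hx⟩ := hmid (n + 1) _ hdb
  refine ⟨x, hx, hinj (n + 2) ?_⟩
  rw [← hom_f_d_apply, hx, d_d_apply, map_zero]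

/-- Independence of the snake recipe from the choices, including the choice of the cocycle in its
class: if `ψ b - ψ b'` is a boundary and `φ x = d b`, `φ x' = d b'`, then `[x] = [x']` in
`Hⁿ⁺¹(K)`. [cite: Shatz1972, Ch. II §1 Prop. 3] -/
theorem cxClass_lift_eq (hinj : ∀ i, Function.Injective (φ.f i))
    (hmid : ∀ i (y : L.X i), ψ.f i y = 0 → ∃ x, φ.f i x = y)
    (hsurj : ∀ i, Function.Surjective (ψ.f i)) (n n₀ : ℕ) (b b' : L.X n)
    (w : M.X n₀) (hw : M.d n₀ n w = ψ.f n b - ψ.f n b')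
    (x x' : K.X (n + 1)) (hx : φ.f (n + 1) x = L.d n (n + 1) b)
    (hx' : φ.f (n + 1) x' = L.d n (n + 1) b') (hdx : K.d (n + 1) (n + 2) x = 0)
    (hdx' : K.d (n + 1) (n + 2) x' = 0) :
    cxClass K (n + 1) (n + 2) (up_nat_next (n + 1)) x hdx =
      cxClass K (n + 1) (n + 2) (up_nat_next (n + 1)) x' hdx' := by
  obtain ⟨b₁, rfl⟩ := hsurj _ w
  have h1 : ψ.f n (b - b' - L.d _ n b₁) = 0 := by
    rw [map_sub, map_sub, ← hom_f_d_apply, hw, sub_self]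
  obtain ⟨a, ha⟩ := hmid n _ h1
  refine cxClass_eq_cxClass_of_sub_eq_d K (n + 1) n (up_nat_prev_succ n) x x' hdx hdx' a ?_
  apply hinj (n + 1)
  rw [← hom_f_d_apply, ha, map_sub, map_sub, d_d_apply, sub_zero, map_sub, hx, hx']

/-- **Existence of the connecting homomorphism** `δ : Hⁿ(M) →ₗ[R] Hⁿ⁺¹(K)` of a degreewise short
exact sequence of complexes of topological modules, characterised by the snake recipe:
`δ [z] = [x]` whenever `z = ψ b` and `φ x = d b`. [cite: Shatz1972, Ch. II §1 Prop. 3]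
[cite: NeukirchSchmidtWingberg2008, (1.3.2)] -/
theorem exists_connectingHom (hinj : ∀ i, Function.Injective (φ.f i))
    (hmid : ∀ i (y : L.X i), ψ.f i y = 0 → ∃ x, φ.f i x = y)
    (hsurj : ∀ i, Function.Surjective (ψ.f i)) (n : ℕ) :
    ∃ δ : M.homology n →ₗ[R] K.homology (n + 1),
      ∀ (z : M.X n) (hz : M.d n (n + 1) z = 0) (b : L.X n), ψ.f n b = z →
        ∀ (x : K.X (n + 1)) (hdx : K.d (n + 1) (n + 2) x = 0),
          φ.f (n + 1) x = L.d n (n + 1) b →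
          δ (cxClass M n (n + 1) (up_nat_next n) z hz) =
            cxClass K (n + 1) (n + 2) (up_nat_next (n + 1)) x hdx := by
  classical
  -- the cocycles of `M` in degree `n`, as a submodule
  let Z : Submodule R (M.X n) := LinearMap.ker (M.d n (n + 1)).hom.toLinearMap
  have hZ : ∀ z : Z, M.d n (n + 1) (z : M.X n) = 0 := fun z => z.2
  -- chosen lifts `b z` and cocycles `x z`
  have hlift : ∀ z : Z, ∃ b : L.X n, ψ.f n b = z := fun z => hsurj n z
  choose b hb using hlift
  have hlift' : ∀ z : Z, ∃ x : K.X (n + 1),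
      φ.f (n + 1) x = L.d n (n + 1) (b z) ∧ K.d (n + 1) (n + 2) x = 0 :=
    fun z => exists_lift_d_eq φ ψ hinj hmid n z (hZ z) (b z) (hb z)
  choose x hx hdx using hlift'
  -- scalar multiplication commutes with the (continuous linear) structure maps
  have hψsmul : ∀ (r : R) (y : L.X n), ψ.f n (r • y) = r • ψ.f n y :=
    fun r y => (ψ.f n).hom.map_smul r y
  have hφsmul : ∀ (r : R) (y : K.X (n + 1)), φ.f (n + 1) (r • y) = r • φ.f (n + 1) y :=
    fun r y => (φ.f (n + 1)).hom.map_smul r y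
  have hKsmul : ∀ (r : R) (y : K.X (n + 1)), K.d (n + 1) (n + 2) (r • y) = r • K.d _ _ y :=
    fun r y => (K.d (n + 1) (n + 2)).hom.map_smul r y
  have hLsmul : ∀ (r : R) (y : L.X n), L.d n (n + 1) (r • y) = r • L.d _ _ y :=
    fun r y => (L.d n (n + 1)).hom.map_smul r y
  -- the recipe on cocycles, as a function
  let δ₀ : Z → K.homology (n + 1) := fun z =>
    cxClass K (n + 1) (n + 2) (up_nat_next (n + 1)) (x z) (hdx z)
  -- its value is independent of the choices
  have key : ∀ (z : Z) (b' : L.X n), ψ.f n b' = z → ∀ (x' : K.X (n + 1))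
      (hdx' : K.d (n + 1) (n + 2) x' = 0), φ.f (n + 1) x' = L.d n (n + 1) b' →
      δ₀ z = cxClass K (n + 1) (n + 2) (up_nat_next (n + 1)) x' hdx' := by
    intro z b' hb' x' hdx' hx'
    exact cxClass_lift_eq φ ψ hinj hmid hsurj n n (b z) b' 0
      (by rw [map_zero, hb, hb', sub_self]) (x z) x' (hx z) hx' (hdx z) hdx'
  -- additivity and linearity of the recipe
  have hadd : ∀ z z' : Z, δ₀ (z + z') = δ₀ z + δ₀ z' := by
    intro z z'
    have h := key (z + z') (b z + b z') (by rw [map_add, hb, hb]; rfl) (x z + x z')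
      (by rw [map_add, hdx, hdx, add_zero]) (by rw [map_add, hx, hx, map_add])
    rw [h, cxClass_add]
  have hsmul : ∀ (r : R) (z : Z), δ₀ (r • z) = r • δ₀ z := by
    intro r z
    have h := key (r • z) (r • b z) (by rw [hψsmul, hb]; rfl) (r • x z)
      (by rw [hKsmul, hdx, smul_zero]) (by rw [hφsmul, hx, hLsmul])
    rw [h, cxClass_smul]
  let δ₁ : Z →ₗ[R] K.homology (n + 1) :=
    { toFun := δ₀, map_add' := hadd, map_smul' := hsmul }
  -- the class map `Z → Hⁿ(M)`: linear, surjective, kernel = boundaries ⊆ ker δ₁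
  let q : Z →ₗ[R] M.homology n :=
    { toFun := fun z => cxClass M n (n + 1) (up_nat_next n) (z : M.X n) (hZ z)
      map_add' := fun z z' =>
        (cxClass_congr (Submodule.coe_add z z')).trans
          (cxClass_add M n (n + 1) (up_nat_next n) (z : M.X n) z' (hZ z) (hZ z'))
      map_smul' := fun r z =>
        (cxClass_congr (Submodule.coe_smul r z)).trans
          (cxClass_smul M n (n + 1) (up_nat_next n) r (z : M.X n) (hZ z)) }
  have hq : Function.Surjective q := fun γ => by
    obtain ⟨z, hz, rfl⟩ := cxClass_surjective M n (n + 1) (up_nat_next n) γ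
    exact ⟨⟨z, hz⟩, rfl⟩
  have hker : LinearMap.ker q ≤ LinearMap.ker δ₁ := by
    intro z hz
    rw [LinearMap.mem_ker] at hz ⊢
    obtain ⟨w, hw⟩ := (cxClass_eq_zero_iff M n (n + 1) (up_nat_next n) _ rfl (z : M.X n)
      (hZ z)).1 hz
    change δ₀ z = 0
    rw [key z (b z) (hb z) (x z) (hdx z) (hx z)]
    have h0 : K.d (n + 1) (n + 2) 0 = 0 := map_zero _
    rw [cxClass_lift_eq φ ψ hinj hmid hsurj n _ (b z) 0 w (by rw [hw, map_zero, sub_zero, hb])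
      (x z) 0 (hx z) (by rw [map_zero, map_zero]) (hdx z) h0]
    exact (cxClass_eq_zero_iff K (n + 1) (n + 2) (up_nat_next (n + 1)) _ rfl 0 h0).2
      ⟨0, map_zero _⟩
  -- descend `δ₁` along `q`
  let e := LinearMap.quotKerEquivOfSurjective q hq
  refine ⟨((LinearMap.ker q).liftQ δ₁ hker).comp e.symm.toLinearMap, ?_⟩
  intro z hz b' hb' x' hdx' hx'
  have hqz : q ⟨z, hz⟩ = cxClass M n (n + 1) (up_nat_next n) z hz := rfl
  rw [← hqz, LinearMap.comp_apply]
  have he : e.symm.toLinearMap (q ⟨z, hz⟩) = Submodule.Quotient.mk ⟨z, hz⟩ := by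
    rw [LinearEquiv.coe_toLinearMap, LinearEquiv.symm_apply_eq]
    rfl
  rw [he, Submodule.liftQ_apply]
  exact key ⟨z, hz⟩ b' hb' x' hdx' hx'

variable {φ ψ}

/-- The value of a connecting homomorphism on a class is forced by the snake recipe (uniqueness
on classes). [cite: Shatz1972, Ch. II §1 Prop. 3] -/
theorem connecting_cxClass_eq (hinj : ∀ i, Function.Injective (φ.f i))
    (hmid : ∀ i (y : L.X i), ψ.f i y = 0 → ∃ x, φ.f i x = y)
    (hsurj : ∀ i, Function.Surjective (ψ.f i)) {n : ℕ}
    {δ δ' : M.homology n →ₗ[R] K.homology (n + 1)}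
    (hδ : ∀ (z : M.X n) (hz : M.d n (n + 1) z = 0) (b : L.X n), ψ.f n b = z →
      ∀ (x : K.X (n + 1)) (hdx : K.d (n + 1) (n + 2) x = 0), φ.f (n + 1) x = L.d n (n + 1) b →
        δ (cxClass M n (n + 1) (up_nat_next n) z hz) =
          cxClass K (n + 1) (n + 2) (up_nat_next (n + 1)) x hdx)
    (hδ' : ∀ (z : M.X n) (hz : M.d n (n + 1) z = 0) (b : L.X n), ψ.f n b = z →
      ∀ (x : K.X (n + 1)) (hdx : K.d (n + 1) (n + 2) x = 0), φ.f (n + 1) x = L.d n (n + 1) b →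
        δ' (cxClass M n (n + 1) (up_nat_next n) z hz) =
          cxClass K (n + 1) (n + 2) (up_nat_next (n + 1)) x hdx) :
    δ = δ' := by
  refine LinearMap.ext fun γ => ?_
  obtain ⟨z, hz, rfl⟩ := cxClass_surjective M n (n + 1) (up_nat_next n) γ
  obtain ⟨b, hb⟩ := hsurj n z
  obtain ⟨x, hx, hdx⟩ := exists_lift_d_eq φ ψ hinj hmid n z hz b hb
  rw [hδ z hz b hb x hdx hx, hδ' z hz b hb x hdx hx]

/-- **Exactness at `Hⁿ⁺¹(K)`**: a class killed by `Hⁿ⁺¹(φ)` is in the image of the connecting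
homomorphism. [cite: Shatz1972, Ch. II §1 Prop. 3] -/
theorem exists_connecting_eq_of_homologyMap_eq_zero
    (hcomp : ∀ i (x : K.X i), ψ.f i (φ.f i x) = 0) {n : ℕ}
    {δ : M.homology n →ₗ[R] K.homology (n + 1)}
    (hδ : ∀ (z : M.X n) (hz : M.d n (n + 1) z = 0) (b : L.X n), ψ.f n b = z →
      ∀ (x : K.X (n + 1)) (hdx : K.d (n + 1) (n + 2) x = 0), φ.f (n + 1) x = L.d n (n + 1) b →
        δ (cxClass M n (n + 1) (up_nat_next n) z hz) =
          cxClass K (n + 1) (n + 2) (up_nat_next (n + 1)) x hdx)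
    (c : K.homology (n + 1)) (hc : HomologicalComplex.homologyMap φ (n + 1) c = 0) :
    ∃ γ : M.homology n, δ γ = c := by
  obtain ⟨x, hdx, rfl⟩ := cxClass_surjective K (n + 1) (n + 2) (up_nat_next (n + 1)) c
  have hφx : L.d (n + 1) (n + 2) (φ.f (n + 1) x) = 0 := by rw [hom_f_d_apply, hdx, map_zero]
  rw [homologyMap_cxClass φ (n + 1) (n + 2) (up_nat_next (n + 1)) x hdx (φ.f (n + 1) x) hφx rfl,
    cxClass_eq_zero_iff L (n + 1) (n + 2) (up_nat_next (n + 1)) n (up_nat_prev_succ n)] at hc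
  obtain ⟨b, hb⟩ := hc
  have hz : M.d n (n + 1) (ψ.f n b) = 0 := by rw [hom_f_d_apply, hb, hcomp]
  exact ⟨_, hδ _ hz _ rfl x hdx hb.symm⟩

/-- **Exactness at `Hⁿ(M)`**: a class killed by the connecting homomorphism is in the image of
`Hⁿ(ψ)`. [cite: Shatz1972, Ch. II §1 Prop. 3] -/
theorem exists_homologyMap_eq_of_connecting_eq_zero
    (hcomp : ∀ i (x : K.X i), ψ.f i (φ.f i x) = 0) (hinj : ∀ i, Function.Injective (φ.f i))
    (hmid : ∀ i (y : L.X i), ψ.f i y = 0 → ∃ x, φ.f i x = y)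
    (hsurj : ∀ i, Function.Surjective (ψ.f i)) {n : ℕ}
    {δ : M.homology n →ₗ[R] K.homology (n + 1)}
    (hδ : ∀ (z : M.X n) (hz : M.d n (n + 1) z = 0) (b : L.X n), ψ.f n b = z →
      ∀ (x : K.X (n + 1)) (hdx : K.d (n + 1) (n + 2) x = 0), φ.f (n + 1) x = L.d n (n + 1) b →
        δ (cxClass M n (n + 1) (up_nat_next n) z hz) =
          cxClass K (n + 1) (n + 2) (up_nat_next (n + 1)) x hdx)
    (γ : M.homology n) (hγ : δ γ = 0) :
    ∃ c : L.homology n, HomologicalComplex.homologyMap ψ n c = γ := by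
  obtain ⟨z, hz, rfl⟩ := cxClass_surjective M n (n + 1) (up_nat_next n) γ
  obtain ⟨b, hb⟩ := hsurj n z
  obtain ⟨x, hx, hdx⟩ := exists_lift_d_eq φ ψ hinj hmid n z hz b hb
  rw [hδ z hz b hb x hdx hx,
    cxClass_eq_zero_iff K (n + 1) (n + 2) (up_nat_next (n + 1)) n (up_nat_prev_succ n)] at hγ
  obtain ⟨a, ha⟩ := hγ
  -- `b - φ a` is a cocycle of `L` mapping to `z`
  have hb' : L.d n (n + 1) (b - φ.f n a) = 0 := by
    rw [map_sub, hom_f_d_apply, ha, hx, sub_self]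
  refine ⟨cxClass L n (n + 1) (up_nat_next n) _ hb', ?_⟩
  exact homologyMap_cxClass ψ n (n + 1) (up_nat_next n) _ hb' z hz
    (by rw [map_sub, hb, hcomp, sub_zero])

/-- `δ ∘ Hⁿ(ψ) = 0` for a connecting homomorphism `δ`. [cite: Shatz1972, Ch. II §1 Prop. 3] -/
theorem connecting_homologyMap_apply {n : ℕ}
    {δ : M.homology n →ₗ[R] K.homology (n + 1)}
    (hδ : ∀ (z : M.X n) (hz : M.d n (n + 1) z = 0) (b : L.X n), ψ.f n b = z →
      ∀ (x : K.X (n + 1)) (hdx : K.d (n + 1) (n + 2) x = 0), φ.f (n + 1) x = L.d n (n + 1) b →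
        δ (cxClass M n (n + 1) (up_nat_next n) z hz) =
          cxClass K (n + 1) (n + 2) (up_nat_next (n + 1)) x hdx)
    (c : L.homology n) : δ (HomologicalComplex.homologyMap ψ n c) = 0 := by
  obtain ⟨b, hb, rfl⟩ := cxClass_surjective L n (n + 1) (up_nat_next n) c
  have hψb : M.d n (n + 1) (ψ.f n b) = 0 := by rw [hom_f_d_apply, hb, map_zero]
  have h0 : K.d (n + 1) (n + 2) 0 = 0 := map_zero _
  rw [homologyMap_cxClass ψ n (n + 1) (up_nat_next n) b hb (ψ.f n b) hψb rfl,
    hδ (ψ.f n b) hψb b rfl 0 h0 (by rw [map_zero, hb])]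
  exact (cxClass_eq_zero_iff K (n + 1) (n + 2) (up_nat_next (n + 1)) _ rfl 0 h0).2
    ⟨0, map_zero _⟩

/-- `Hⁿ⁺¹(φ) ∘ δ = 0` for a connecting homomorphism `δ`. [cite: Shatz1972, Ch. II §1 Prop. 3] -/
theorem homologyMap_connecting_apply (hinj : ∀ i, Function.Injective (φ.f i))
    (hmid : ∀ i (y : L.X i), ψ.f i y = 0 → ∃ x, φ.f i x = y)
    (hsurj : ∀ i, Function.Surjective (ψ.f i)) {n : ℕ}
    {δ : M.homology n →ₗ[R] K.homology (n + 1)}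
    (hδ : ∀ (z : M.X n) (hz : M.d n (n + 1) z = 0) (b : L.X n), ψ.f n b = z →
      ∀ (x : K.X (n + 1)) (hdx : K.d (n + 1) (n + 2) x = 0), φ.f (n + 1) x = L.d n (n + 1) b →
        δ (cxClass M n (n + 1) (up_nat_next n) z hz) =
          cxClass K (n + 1) (n + 2) (up_nat_next (n + 1)) x hdx)
    (γ : M.homology n) : HomologicalComplex.homologyMap φ (n + 1) (δ γ) = 0 := by
  obtain ⟨z, hz, rfl⟩ := cxClass_surjective M n (n + 1) (up_nat_next n) γ
  obtain ⟨b, hb⟩ := hsurj n z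
  obtain ⟨x, hx, hdx⟩ := exists_lift_d_eq φ ψ hinj hmid n z hz b hb
  have hφx : L.d (n + 1) (n + 2) (φ.f (n + 1) x) = 0 := by rw [hom_f_d_apply, hdx, map_zero]
  rw [hδ z hz b hb x hdx hx,
    homologyMap_cxClass φ (n + 1) (n + 2) (up_nat_next (n + 1)) x hdx (φ.f (n + 1) x) hφx rfl]
  exact (cxClass_eq_zero_iff L (n + 1) (n + 2) (up_nat_next (n + 1)) n (up_nat_prev_succ n)
    _ hφx).2 ⟨b, hx.symm⟩

end Complexes

end Literature.NumberTheory.GaloisRepresentations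

end
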